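import Summits.PneNP.PneNP.Theses.BISOrderDimension
import Literature.Computability.Complexity.CountingHierarchyProofs
import Literature.Computability.Complexity.CodeFPArith
import Literature.Computability.MetaComplexity.ConstructiveSeparationsProofs

/-!
# Route BISOrderDimension — FPRAS pull back along a count-preserving `FP` map (helper for `DimThreeToIdeals`, stmt-PneNP-2095)

The shared glue lemma of the route: if `f' = f ∘ g` for a polynomial-time string map `g`, then an FPRAS for `f` (in the
route's shape: `F ∈ FP`, a coin budget `c`, and for every `x, kη, kδ ≥ 1` all but a `1/kδ` fraction of the coin strings
`u ∈ {0,1}^{c(|x|+kη+kδ)}` give an answer within the factor `1 + 1/kη` of `f x`) yields an FPRAS for `f'`: on the query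
`⟨⟨x, params⟩, u⟩` run `F` on `⟨⟨g x, params⟩, u↾c(|g x|+kη+kδ)⟩`; the new coin budget `c ∘ (q + X)` (`|g x| ≤ q |x|`)
is long enough, and the failure event is a cylinder over the failure event of `F` at `g x` (`uniformProb_take_of_le`).
-/

set_option linter.dupNamespace false -- `Summit.PneNP.PneNP.…`: summit = sub-problem name (D-0017 single-conjunct layout)

namespace Summit.PneNP.PneNP.Theorems

open _root_.Computability Polynomial
open Literature.Computability.Complexity Literature.Computability.Complexity.CodeFP
  Literature.Computability.Complexity.Brick

/-- **The pulled-back counter is polynomial time**: `⟨⟨x, P⟩, u⟩ ↦ F ⟨⟨g x, P⟩, u↾c(|g x| + |P₂₁| + |P₂₂|)⟩` (the two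
unary accuracy fields of `P = ⟨1^m, ⟨1^{kη}, 1^{kδ}⟩⟩` are read off by their lengths). [cite: AroraBarakCC2009, §1.3] -/
theorem bisOrderDimension_pullbackCounter_mem_FP {F g : List Bool → List Bool} (hF : F ∈ FP) (hg : g ∈ FP) (c : Polynomial ℕ) :
    (fun w : List Bool => F (boolPair (boolPair (g (fstF (fstF w))) (sndF (fstF w)))
      ((sndF w).take (c.eval ((g (fstF (fstF w))).length + (fstF (sndF (sndF (fstF w)))).length +
        (sndF (sndF (sndF (fstF w)))).length))))) ∈ FP := by
  have hfst : CodeFP strE strE fun w : List Bool => fstF w := CodeFP.of_fn fstF fstF_mem_FP fun _ => rfl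
  have hsnd : CodeFP strE strE fun w : List Bool => sndF w := CodeFP.of_fn sndF sndF_mem_FP fun _ => rfl
  have hgc : CodeFP strE strE g := CodeFP.of_fn g hg fun _ => rfl
  have hF3 : CodeFP (pairE (pairE strE strE) strE) strE fun t : (List Bool × List Bool) × List Bool =>
      F (boolPair (boolPair t.1.1 t.1.2) t.2) := ⟨F, hF, fun _ => rfl⟩
  have hx : CodeFP strE strE fun w : List Bool => fstF (fstF w) := (hfst.comp hfst :)
  have hP : CodeFP strE strE fun w : List Bool => sndF (fstF w) := (hsnd.comp hfst :)
  have hgx : CodeFP strE strE fun w : List Bool => g (fstF (fstF w)) := (hgc.comp hx :)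
  have hl1 : CodeFP strE unE fun w : List Bool => (g (fstF (fstF w))).length := (strLength.comp hgx :)
  have hl2 : CodeFP strE unE fun w : List Bool => (fstF (sndF (sndF (fstF w)))).length :=
    (strLength.comp (hfst.comp (hsnd.comp (hsnd.comp hfst))) :)
  have hl3 : CodeFP strE unE fun w : List Bool => (sndF (sndF (sndF (fstF w)))).length :=
    (strLength.comp (hsnd.comp (hsnd.comp (hsnd.comp hfst))) :)
  have hN : CodeFP strE unE fun w : List Bool => c.eval ((g (fstF (fstF w))).length + (fstF (sndF (sndF (fstF w)))).length +
      (sndF (sndF (sndF (fstF w)))).length) := ((Literature.Computability.MetaComplexity.GSTRefuter.codeFP_unPoly c).comp (unAdd.comp ((unAdd.comp (hl1.pair hl2)).pair hl3)) :)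
  have htake := (strTake.comp (hN.pair hsnd) :)
  obtain ⟨F', hF', hspec⟩ := (hF3.comp ((hgx.pair hP).pair htake) :)
  convert hF' using 1
  funext w
  exact (hspec w).symm

/-- **An FPRAS pulls back along an exactly count-preserving `FP` map** (route shape of `IdealsNoFPRAS` / `DimThreeNoFPRAS`).
[cite: AroraBarak2009, §7.1 (irrelevant coins)] [folklore] -/
theorem bisOrderDimension_fpras_pullback {f f' : List Bool → ℕ} {g : List Bool → List Bool} (hg : g ∈ FP)
    (hfg : ∀ x, f' x = f (g x))
    (hF : ∃ F ∈ FP, ∃ c : Polynomial ℕ, ∀ (x : List Bool) (kη kδ : ℕ), 0 < kη → 0 < kδ →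
      uniformProb (c.eval (x.length + kη + kδ)) {u | ¬ IsApproxCount kη (f x) (countEstimate F x 0 kη kδ u)} ≤ 1 / (kδ : ℝ)) :
    ∃ F ∈ FP, ∃ c : Polynomial ℕ, ∀ (x : List Bool) (kη kδ : ℕ), 0 < kη → 0 < kδ →
      uniformProb (c.eval (x.length + kη + kδ)) {u | ¬ IsApproxCount kη (f' x) (countEstimate F x 0 kη kδ u)} ≤ 1 / (kδ : ℝ) := by
  obtain ⟨F, hFP, c, hc⟩ := hF
  obtain ⟨q, hq⟩ := exists_poly_length_le_of_mem_FP hg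
  refine ⟨_, bisOrderDimension_pullbackCounter_mem_FP hFP hg c, c.comp (q + X), fun x kη kδ hη hδ => ?_⟩
  have hunary : ∀ n : ℕ, (unaryEncodeNat n).length = n := length_unE
  -- the value of the new counter on a query
  have hval : ∀ u : List Bool, countEstimate (fun w : List Bool => F (boolPair (boolPair (g (fstF (fstF w))) (sndF (fstF w)))
      ((sndF w).take (c.eval ((g (fstF (fstF w))).length + (fstF (sndF (sndF (fstF w)))).length +
        (sndF (sndF (sndF (fstF w)))).length))))) x 0 kη kδ u =
      countEstimate F (g x) 0 kη kδ (u.take (c.eval ((g x).length + kη + kδ))) := by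
    intro u
    simp only [countEstimate_def, countQuery, fstF_boolPair, sndF_boolPair, hunary]
  have hset : {u | ¬ IsApproxCount kη (f' x) (countEstimate (fun w : List Bool => F (boolPair (boolPair (g (fstF (fstF w)))
      (sndF (fstF w))) ((sndF w).take (c.eval ((g (fstF (fstF w))).length + (fstF (sndF (sndF (fstF w)))).length +
        (sndF (sndF (sndF (fstF w)))).length))))) x 0 kη kδ u)} =
      {u | u.take (c.eval ((g x).length + kη + kδ)) ∈ {v | ¬ IsApproxCount kη (f (g x)) (countEstimate F (g x) 0 kη kδ v)}} := by
    ext u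
    simp only [Set.mem_setOf_eq, hval, hfg]
  have hle : c.eval ((g x).length + kη + kδ) ≤ (c.comp (q + X)).eval (x.length + kη + kδ) := by
    rw [eval_comp, eval_add, eval_X]
    refine TM2Iter.eval_mono c ?_
    have h1 := hq x
    have h2 : q.eval x.length ≤ q.eval (x.length + kη + kδ) := TM2Iter.eval_mono q (by omega)
    omega
  rw [hset, uniformProb_take_of_le hle]
  exact hc (g x) kη kδ hη hδ

end Summit.PneNP.PneNP.Theorems
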